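import Summits.Langlands.Langlands.Theses.IrreducibilityBySelfDuality
import Literature.NumberTheory.GaloisRepresentations.HeckeCharacterArchType
import Literature.NumberTheory.GaloisRepresentations.HeckeCharacterProofs
import Literature.NumberTheory.GaloisRepresentations.AlgebraicHeckeCharacterGrossencharakterProofs
import Literature.NumberTheory.NumberFields.ChevalleyUnitCongruence

/-!
# Sketch (crux-ideate, ideator 1, round 1) for crux `HalfIntegralTwistCM` (stmt-Langlands-14036)

First-lemma signatures of the two idea cards

* `two-primary-chevalley-core`  — §A
* `even-angular-square-root`    — §B

Everything here only has to ELABORATE (planner sketch; `sorry` allowed).  Names of tree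
declarations were checked with `lean search`.
-/

set_option linter.dupNamespace false

noncomputable section

open NumberField
open Literature.NumberTheory.GaloisRepresentations

namespace Summit.Langlands.Langlands.Cruxes.HalfIntegralTwistCM.SketchIdeator1

/-- The crux under discussion, by name. -/
abbrev Crux : Prop := Summit.Langlands.Langlands.Theses.IrreducibilityBySelfDuality.HalfIntegralTwistCM

/-! ## §A  Card `two-primary-chevalley-core` -/

/-- (A1) **2-power Chevalley for the unit group, modulo torsion** — the ONLY deep arithmetic input
of the crux (and, by the necessity note, unavoidable): for every number field `K` and every `b`
there is a rational modulus `a > 0` such that every unit `u ≡ 1 (mod a)` is a root of unity times a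
`2^b`-th power of a unit.  (Weaker than `Chevalley1951.thm1_units` with `m = 2^b`: torsion allowed,
only 2-power exponents.) -/
def UnitsCongruenceTwoPowModTorsion : Prop :=
  ∀ (K : Type) [Field K] [NumberField K] (b : ℕ),
    ∃ a : ℕ, 0 < a ∧ ∀ u : (𝓞 K)ˣ, (a : 𝓞 K) ∣ (u : 𝓞 K) - 1 →
      ∃ ζ ∈ NumberField.Units.torsion K, ∃ w : (𝓞 K)ˣ, u = ζ * w ^ (2 ^ b)

/-- (A1') sanity: the tree's named fact (general exponent) implies (A1). -/
theorem unitsCongruenceTwoPowModTorsion_of_chevalley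
    (h : Literature.NumberTheory.NumberFields.Chevalley1951.thm1_units) :
    UnitsCongruenceTwoPowModTorsion := by
  intro K _ _ b
  obtain ⟨a, ha, -, h⟩ := h K (2 ^ b) (by positivity) 1 Nat.one_pos
  exact ⟨a, ha, fun u hu => ⟨1, one_mem _, (h u hu).imp fun w hw => by simpa using hw⟩⟩

/-- (A2) **Weil extension in CONGRUENCE form** (no Chevalley inside): a continuous quasi-character
of the infinite ideles `(K ⊗ ℝ)ˣ` that kills the global units `≡ 1 (mod a)` is the infinite
component of a Hecke character.  (Template in tree: `HeckeCharacter.exists_of_isRayClassCharacter`,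
Tate's Prop. 4.1 via weak approximation, finite-order case.) -/
def ExistsHeckeCharacterOfArchCharTrivialOnCongruenceUnits : Prop :=
  ∀ (K : Type) [Field K] [NumberField K] (f : (InfiniteAdeleRing K)ˣ →ₜ* ℂˣ) (a : ℕ), 0 < a →
    (∀ u : (𝓞 K)ˣ, (a : 𝓞 K) ∣ (u : 𝓞 K) - 1 →
      f (globalToInfiniteUnits K (Units.map (algebraMap (𝓞 K) K : 𝓞 K →* K) u)) = 1) →
    ∃ χ : HeckeCharacter K, ∀ x : (InfiniteAdeleRing K)ˣ, χ (infiniteIdeles K x) = f x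

/-- (A3) **Odd-index absorption** (the lever, pure group theory; PROVED): let `V ≤ U` (commutative)
have index `2^a · n` with `n` odd, `V` torsion-free, and let `ε` be a character of `V` trivial on
squares.  Then `ε` kills every element of `V` of the form `ζ · w^(2^(a+1))` with `ζ` torsion.
Applied to `U = 𝓞_Kˣ`, `V = U_𝔥` (units `≡ 1 mod 𝔥`, `𝔥` a level of `ω_f` killing roots of
unity), `ε = χ_∞|_V`: with (A1) for `b = a+1` one gets `U_𝔤 ∩ U_𝔥 ⊆ ker χ_∞` — only 2-POWER
Chevalley is ever needed, never odd exponents (which would drag in `ζ_p`-Kummer theory). -/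
theorem oddIndexAbsorption {U : Type*} [CommGroup U] (V : Subgroup U) (a n : ℕ) (hn : Odd n)
    (hidx : V.index = 2 ^ a * n) (htf : ∀ v ∈ V, IsOfFinOrder v → v = 1)
    (ε : V →* ℂˣ) (hε : ∀ v : V, ε (v ^ 2) = 1)
    (u : V) (ζ w : U) (hζ : IsOfFinOrder ζ) (hu : (u : U) = ζ * w ^ (2 ^ (a + 1))) :
    ε u = 1 := by
  -- `w ^ [U:V] ∈ V`
  have hw : w ^ (2 ^ a * n) ∈ V := hidx ▸ V.pow_index_mem w
  set v₀ : V := ⟨w ^ (2 ^ a * n), hw⟩ with hv₀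
  -- `u ^ n = ζ ^ n * v₀ ^ 2` in `U`
  have hpow : (u : U) ^ n = ζ ^ n * (v₀ : U) ^ 2 := by
    rw [hu, mul_pow, ← pow_mul, hv₀, Subgroup.coe_mk, ← pow_mul]
    congr 1
    ring
  -- hence `ζ ^ n ∈ V` is torsion, so `ζ ^ n = 1`
  have hζn_mem : ζ ^ n ∈ V := by
    have h : (u : U) ^ n * ((v₀ : U) ^ 2)⁻¹ = ζ ^ n := by rw [hpow, mul_inv_cancel_right]
    rw [← h]
    exact V.mul_mem (V.pow_mem u.2 n) (V.inv_mem (V.pow_mem v₀.2 2))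
  have hζn : ζ ^ n = 1 := htf _ hζn_mem hζ.pow
  have hun : u ^ n = v₀ ^ 2 := by
    apply Subtype.ext
    rw [SubgroupClass.coe_pow, SubgroupClass.coe_pow, hpow, hζn, one_mul]
  have h1 : ε u ^ n = 1 := by rw [← map_pow, hun, hε]
  have h2 : ε u ^ 2 = 1 := by rw [← map_pow]; exact hε u
  obtain ⟨k, rfl⟩ := hn
  have h3 : ε u ^ (2 * k + 1) = (ε u ^ 2) ^ k * ε u := by rw [pow_succ, pow_mul]
  rw [h2, one_pow, one_mul, h1] at h3
  exact h3.symm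

/-- (A4) The archimedean shadow that makes `ε` quadratic: under (ii) and (iii) the angular integers
`e_w = E(ι_w) - E(ῑ_w)` of `ω` are EVEN (`E = s₁ + s₂`). Pure algebra over `ℂ`. -/
theorem angularInteger_even (s₁ s₂ s₁c s₂c : ℂ) (k kc m M : ℤ)
    (hk : s₁ - s₂ = k) (_hkc : s₁c - s₂c = kc) (hm : s₁ - s₁c = m)
    (hM : (s₁ - s₂) + (s₁c - s₂c) = 2 * M) :
    ∃ e : ℤ, (s₁ + s₂) - (s₁c + s₂c) = 2 * e := by
  refine ⟨m - k + M, ?_⟩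
  push_cast
  linear_combination -2 * hk + 2 * hm + hM

/-! ## §B  Card `even-angular-square-root` -/

/-- (B1) **Square roots modulo finite order** (field-uniform; Patrikis arXiv:1207.6724 Cor. 2.1.8 in
existence form): a Hecke character whose archimedean component admits a continuous square root on
`(K ⊗ ℝ)ˣ` (for totally complex `K`: all angular integers even) is a square up to a finite-order
character.  Its proof is Weil's congruence criterion for the forced `√Θ_∞` — i.e. (A2) + (A3) + (A1). -/
def SqrtModFiniteOrderOfArchSqrt : Prop :=
  ∀ (K : Type) [Field K] [NumberField K] (Θ : HeckeCharacter K),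
    (∃ f : (InfiniteAdeleRing K)ˣ →ₜ* ℂˣ, ∀ x, f x ^ 2 = Θ (infiniteIdeles K x)) →
      ∃ ψ μ : HeckeCharacter K, μ.IsFiniteOrder ∧ ψ ^ 2 = Θ * μ

/-- (B2) **CM weight-zero angular characters** (the ONLY place `IsCMField` is used on this line;
ELEMENTARY unit condition — units `≡ 1 mod m`, `m ≥ 3`, of a CM field are real, so the even angular
character is trivial on them; then (A2)): for `K` CM and even `m_w`, there is a Hecke character with
unitary archimedean type `x ↦ ∏_w (ι_w x_w / |ι_w x_w|)^{m_w}` (= algebraic type `(m_w/2, -m_w/2)`). -/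
def ExistsCMAngularCharEven : Prop :=
  ∀ (K : Type) [Field K] [NumberField K], IsCMField K →
    ∀ m : InfinitePlace K → ℤ, (∀ w, Even (m w)) →
      ∃ θ : HeckeCharacter K, θ.HasUnitaryArchType m 0

/-- (B3) The TRANSFER of card B: `C⁺ := (B1) ∧ (B2)` implies the crux by exponent bookkeeping
(`Θ := ‖·‖ · ω⁻¹ · θ_m` with `m_w ≡ -2 k_{ι_w} (mod 4)`, `χ := ψ`, `p ι = type(Θ, ι)/2`) plus the
GL(1) dictionary already in tree (`exists_heckeCharacter_glOne`, `archParameter_clauses_glOne`,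
`exists_cuspidalAutomorphicRepData…detTwist_glOne`, `hasArchParameter_glOne_of_eq_smul_one`). -/
theorem crux_of_transferB (h1 : SqrtModFiniteOrderOfArchSqrt) (h2 : ExistsCMAngularCharEven) :
    Crux := by
  sorry

/-- (B4) the bookkeeping identity behind (B3), at one complex place: with `E = s₁ + s₂`,
`k = s₁ - s₂ ∈ ℤ`, angular parameter `m ≡ -2k (mod 4)` of `θ`, the type of
`Θ = ‖·‖ ω⁻¹ θ` at `ι` is `1 - E + m/2`, and HALF of it is `½ - s₁` plus an integer. -/
theorem half_type_bookkeeping (s₁ s₂ : ℂ) (k m j : ℤ) (hk : s₁ - s₂ = k) (hm : m = -2 * k + 4 * j) :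
    ∃ N : ℤ, (1 - (s₁ + s₂) + (m : ℂ) / 2) / 2 = 1 / 2 - s₁ + N := by
  refine ⟨j, ?_⟩
  have : (m : ℂ) = -2 * k + 4 * j := by exact_mod_cast hm
  rw [this]
  linear_combination (1 / 2 : ℂ) * hk

end Summit.Langlands.Langlands.Cruxes.HalfIntegralTwistCM.SketchIdeator1
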